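import Mathlib
import Summits.MatrixMultiplication.MatrixMultiplication.Theorems.SnSubsetDichotomyPolynomialSlackRestrictedLevelOne
import Summits.MatrixMultiplication.MatrixMultiplication.Theorems.SnSubsetDichotomyPolynomialSlackMarginals

/-!
# Light-cell energy of a pair profile

Crux `Summit.MatrixMultiplication.MatrixMultiplication.Theses.SnSubsetDichotomy.PolynomialSlack`
(item `stmt-MatrixMultiplication-8306`), level-one programme, line transport-split-hull (lead c6).
For `X, Y ⊆ S_n` with `(x, y) ↦ x⁻¹y` injective on `X × Y`, the PROFILE of the pair is
`d(i,j) = m_{XY}(i,j)/(|X||Y|)` with `m_{XY}(i,j) = #{(x,y) ∈ X × Y : y j = x i}`; it is the profile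
of the quotient SET `A = X⁻¹Y`, which has `|A| = |X||Y|` (`card_image₂_of_injOn'`) and marginals
`#{a ∈ A : a j = i} = m_{XY}(i,j)` (`pairMarginal_eq_marginal_image₂`). The restricted level-one
inequality `restricted_level_one` for `A` with `λ = nθ`, divided by `|A|²`, is the profile form

  `Σ_{d(i,j) < θ} (d(i,j) - 1/n)² ≤ 100·(1 + log n)·(nθ)·log(4n·n!/(|X||Y|))/n`   (`pair_light_energy`).
-/

namespace Summit.MatrixMultiplication.MatrixMultiplication.Theorems.PolynomialSlack

set_option linter.dupNamespace false

open scoped BigOperators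

/-- **Light-cell energy of a pair profile.** For non-empty `X, Y ⊆ S_n` with `(x,y) ↦ x⁻¹y`
injective on `X × Y`, profile `d(i,j) = m_{XY}(i,j)/(|X||Y|)` and threshold `θ ≥ 1/n`,
`Σ_{(i,j) : d(i,j) < θ} (d(i,j) - 1/n)² ≤ 100·(1 + log n)·(nθ)·log(4n·n!/(|X||Y|))/n`.
Proof: `restricted_level_one` for the quotient set `A = X⁻¹Y` (`|A| = |X||Y|`, marginals `m_{XY}`)
with `λ = nθ ≥ 1`, divided by `|A|²` cellwise. [folklore] -/
theorem pair_light_energy {n : ℕ} (hn : 1 ≤ n) (X Y : Finset (Equiv.Perm (Fin n))) (hX : X.Nonempty)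
    (hY : Y.Nonempty)
    (hinj : Set.InjOn (fun xy : Equiv.Perm (Fin n) × Equiv.Perm (Fin n) => xy.1⁻¹ * xy.2)
      (↑X ×ˢ ↑Y : Set (Equiv.Perm (Fin n) × Equiv.Perm (Fin n))))
    (d : Fin n → Fin n → ℝ)
    (hd : ∀ i j, d i j =
      (((X ×ˢ Y).filter fun xy => xy.2 j = xy.1 i).card : ℝ) / (X.card * Y.card : ℕ))
    (θ : ℝ) (hθ : 1 / (n : ℝ) ≤ θ) :
    ∑ i : Fin n, ∑ j : Fin n, (if θ ≤ d i j then (0 : ℝ) else d i j - 1 / n) ^ 2 ≤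
      100 * (1 + Real.log n) * ((n : ℝ) * θ) *
        Real.log (4 * n * n.factorial / (X.card * Y.card : ℕ)) / n := by
  classical
  -- the quotient set `A = X⁻¹Y`, `|A| = |X||Y| > 0`
  set A : Finset (Equiv.Perm (Fin n)) :=
    Finset.image₂ (fun x y : Equiv.Perm (Fin n) => x⁻¹ * y) X Y with hA
  have hAcard : A.card = X.card * Y.card := card_image₂_of_injOn' hinj
  have hXY : 0 < X.card * Y.card := Nat.mul_pos hX.card_pos hY.card_pos
  have hAne : A.Nonempty := by
    rw [← Finset.card_pos, hAcard]; exact hXY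
  have hnR : (1 : ℝ) ≤ n := by exact_mod_cast hn
  have hn0 : (0 : ℝ) < n := by linarith
  -- `λ = nθ ≥ 1`
  have hlam : (1 : ℝ) ≤ n * θ := by
    have h1 := mul_le_mul_of_nonneg_left hθ hn0.le
    rwa [mul_one_div_cancel hn0.ne'] at h1
  -- the restricted level-one inequality for `A`
  have h := restricted_level_one hn A hAne (n * θ) hlam
  rw [hAcard] at h
  set α : ℝ := ((X.card * Y.card : ℕ) : ℝ) with hα
  have hα0 : 0 < α := by rw [hα]; exact_mod_cast hXY
  -- marginals of `A` are `α · d`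
  have hM : ∀ i j, ((A.filter fun a => a j = i).card : ℝ) = α * d i j := fun i j => by
    rw [hd, ← pairMarginal_eq_marginal_image₂ hinj i j]
    field_simp
  -- cellwise identity: stub cell = tree cell / α²
  have hcell : ∀ i j, (if θ ≤ d i j then (0 : ℝ) else d i j - 1 / n) ^ 2 =
      (1 / α ^ 2) * (if ((A.filter fun a => a j = i).card : ℝ) < n * θ * α / n then
        (((A.filter fun a => a j = i).card : ℝ) - α / n) ^ 2 else 0) := fun i j => by
    rw [hM i j]
    have hthr : n * θ * α / n = α * θ := by field_simp
    rw [hthr]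
    by_cases hc : θ ≤ d i j
    · have h1 : ¬ (α * d i j < α * θ) := not_lt.mpr (mul_le_mul_of_nonneg_left hc hα0.le)
      rw [if_pos hc, if_neg h1]; ring
    · have h1 : α * d i j < α * θ := mul_lt_mul_of_pos_left (not_le.mp hc) hα0
      rw [if_neg hc, if_pos h1]
      field_simp
  calc ∑ i : Fin n, ∑ j : Fin n, (if θ ≤ d i j then (0 : ℝ) else d i j - 1 / n) ^ 2
      = (1 / α ^ 2) * ∑ i : Fin n, ∑ j : Fin n,
          (if ((A.filter fun a => a j = i).card : ℝ) < n * θ * α / n then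
            (((A.filter fun a => a j = i).card : ℝ) - α / n) ^ 2 else 0) := by
        rw [Finset.mul_sum]
        refine Finset.sum_congr rfl fun i _ => ?_
        rw [Finset.mul_sum]
        exact Finset.sum_congr rfl fun j _ => hcell i j
    _ ≤ (1 / α ^ 2) * (100 * (1 + Real.log n) * (n * θ) * (α ^ 2 / n) *
          Real.log (4 * n * n.factorial / α)) :=
        mul_le_mul_of_nonneg_left h (by positivity)
    _ = 100 * (1 + Real.log n) * ((n : ℝ) * θ) * Real.log (4 * n * n.factorial / α) / n := by
        field_simp
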